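import Summits.ValiantsHypothesis.ValiantsHypothesis.Theorems.NewtonUnitEquationsTwoProductsExpBlockTensor

/-!
# K10 `exp-block-tensorisation` — SHALLOW THEOREM Q, abstract form: configuration shadows of SHALLOW block configurations by HALVING

Price P1 of val-idea-crit-8 g2's VERDICT #13 (`ShallowQ`), abstract engine.  Blocks are the elements of a `Finset` of an arbitrary finite
index type (no `Fin (n₁+n₂)` reindexing); a SHALLOW configuration over a block set `s` at budget `n` consists of the block tuples
`a : ι → Expo` supported in `s` with a level vector `r` (`Σ_{B∈s} r_B ≤ n`, `a_B ∈ F_B(r_B)`); columns are block products `Π_{B∈s} c_B(a_B)`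
and planar coordinates are additive.  HALVING: for `s = s₁ ⊔ s₂` the restriction map `a ↦ (a|s₁, a|s₁ᶜ)` is injective and maps
`shallow(s, n)` EXACTLY onto `⋃_{n₁ ≤ n} shallow(s₁, n₁) ×ˢ shallow(s₂, n − n₁)`, so the landed embedding lemma
(`QuasiPoly.ncard_cshadow_le_of_embedding`), subadditivity of configuration shadows under unions (val-idea-37 g2's brick, here
`cshadow_union_subset` / `ncard_cshadow_biUnion_le`) and the landed product step (`QuasiPoly.ncard_cshadow_prod_le`) give
`S(s, n) ≤ (n+1)·[2k²(k S(s₁,·) + k S(s₂,·) + 1) + 2k + 1]`, the induction running over ALL budgets (shadows are not monotone in the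
configuration); with `#blockframe ≤ σ` this yields `#cshadow ≤ (σ+2)·((n+1)·8(k+2)³)^⌈log₂ #s⌉` (`ncard_cshadow_shallow_le`).
Helper mode (`--supports stmt-ValiantsHypothesis-5906 --as helper`).  Honest framing: counting engine only (the instantiation `ShallowQ` and the
bridge `ShallowVisible` are separate); nothing here closes 5906 or 5905; VP ≠ VNP is NOT proved.  No instances, no notation, no named facts. [folklore]
-/

noncomputable section
set_option linter.dupNamespace false

namespace Summit.ValiantsHypothesis.ValiantsHypothesis.Theorems.NewtonUnitEquations.TwoProducts.ExpBlock

open MvPolynomial Finset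
open Summit.ValiantsHypothesis.ValiantsHypothesis.Theorems.NewtonUnitEquations.TwoProducts.FormalLogLinearisation
open Summit.ValiantsHypothesis.ValiantsHypothesis.Theorems.NewtonUnitEquationsDissociatedUniform

/-! ## Unions of configurations (val-idea-37 g2's brick, Sketch v3 l.222–251 verbatim) -/

/-- A greedy point of `E ∪ E'` for a height is a greedy point of whichever part contains it (fewer higher points ⇒ smaller span). -/
theorem gE_union_subset {α : Type} [DecidableEq α] {k : ℕ} (E E' : Finset α) (x : α → Fin k → ℂ) (h : α → ℝ) :
    QuasiPoly.gE (E ∪ E') x h ⊆ QuasiPoly.gE E x h ∪ QuasiPoly.gE E' x h := by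
  intro e he
  simp only [QuasiPoly.gE, Set.mem_setOf_eq, Finset.mem_union] at he
  obtain ⟨hmem, hnot⟩ := he
  have key : ∀ F : Finset α, F ⊆ E ∪ E' → e ∈ F → e ∈ QuasiPoly.gE F x h := by
    intro F hF heF
    refine ⟨heF, fun hspan => hnot ?_⟩
    refine Submodule.span_mono ?_ hspan
    refine Set.image_mono ?_
    intro e' he'
    simp only [Set.mem_setOf_eq] at he' ⊢
    exact ⟨by simpa [Finset.mem_union] using hF he'.1, he'.2⟩
  rcases hmem with heE | heE'
  · exact Or.inl (key E Finset.subset_union_left heE)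
  · exact Or.inr (key E' Finset.subset_union_right heE')

/-- SUBADDITIVITY: `cshadow (E ∪ E') ⊆ cshadow E ∪ cshadow E'` (injectivity of the height restricts to the parts). -/
theorem cshadow_union_subset {α : Type} [DecidableEq α] {k : ℕ} (E E' : Finset α) (x : α → Fin k → ℂ) (X Y : α → ℝ) :
    QuasiPoly.cshadow (E ∪ E') x X Y ⊆ QuasiPoly.cshadow E x X Y ∪ QuasiPoly.cshadow E' x X Y := by
  intro e he
  obtain ⟨w, hinj, hg⟩ := he
  have hinjE : Set.InjOn (QuasiPoly.lin X Y w) (E : Set α) :=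
    hinj.mono (by intro a ha; simpa [Finset.mem_union] using Or.inl ha)
  have hinjE' : Set.InjOn (QuasiPoly.lin X Y w) (E' : Set α) :=
    hinj.mono (by intro a ha; simpa [Finset.mem_union] using Or.inr ha)
  rcases gE_union_subset E E' x (QuasiPoly.lin X Y w) hg with hgE | hgE'
  · exact Or.inl ⟨w, hinjE, hgE⟩
  · exact Or.inr ⟨w, hinjE', hgE'⟩

/-- Subadditivity of the shadow count over a finite union of configurations. [folklore] -/
theorem ncard_cshadow_biUnion_le {α κ : Type} [DecidableEq α] {k : ℕ} (t : Finset κ) (E : κ → Finset α) (x : α → Fin k → ℂ)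
    (X Y : α → ℝ) :
    (QuasiPoly.cshadow (t.biUnion E) x X Y).ncard ≤ ∑ i ∈ t, (QuasiPoly.cshadow (E i) x X Y).ncard := by
  classical
  induction t using Finset.induction_on with
  | empty =>
    rw [Finset.biUnion_empty, Finset.sum_empty]
    have : QuasiPoly.cshadow (∅ : Finset α) x X Y = ∅ :=
      Set.eq_empty_of_subset_empty fun e he => by simpa using QuasiPoly.cshadow_subset _ _ _ _ he
    rw [this, Set.ncard_empty]
  | insert i t hi ih =>
    rw [Finset.biUnion_insert, Finset.sum_insert hi]
    calc (QuasiPoly.cshadow (E i ∪ t.biUnion E) x X Y).ncard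
        ≤ (QuasiPoly.cshadow (E i) x X Y ∪ QuasiPoly.cshadow (t.biUnion E) x X Y).ncard :=
          Set.ncard_le_ncard (cshadow_union_subset _ _ _ _ _)
            ((QuasiPoly.cshadow_finite _ _ _ _).union (QuasiPoly.cshadow_finite _ _ _ _))
      _ ≤ (QuasiPoly.cshadow (E i) x X Y).ncard + (QuasiPoly.cshadow (t.biUnion E) x X Y).ncard := Set.ncard_union_le _ _
      _ ≤ _ := Nat.add_le_add_left ih _

/-! ## Shallow configurations over a set of blocks -/

section Shallow

variable {ι : Type} [Fintype ι] [DecidableEq ι] {k : ℕ}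
variable (F : ι → ℕ → Finset Expo) (c : ι → Expo → Fin k → ℂ)

/-- The shallow configuration over the block set `s` at budget `n`: block tuples supported in `s` with a level vector `r`, `Σ_{B∈s} r_B ≤ n`,
`a_B ∈ F_B (r_B)`. [folklore] -/
def shallowCfg (s : Finset ι) (n : ℕ) : Finset (ι → Expo) :=
  (Fintype.piFinset fun B => if B ∈ s then (Finset.range (n + 1)).biUnion (F B) else {0}).filter
    fun a => ∃ r : ι → Fin (n + 1), (∑ B ∈ s, (r B : ℕ)) ≤ n ∧ ∀ B ∈ s, a B ∈ F B (r B)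

/-- Block-product columns over `s`. [folklore] -/
def colS (s : Finset ι) (a : ι → Expo) : Fin k → ℂ := fun i => ∏ B ∈ s, c B (a B) i

/-- First planar coordinate of the point of a block tuple over `s`. [folklore] -/
def XS (s : Finset ι) (a : ι → Expo) : ℝ := (((∑ B ∈ s, a B) (0 : Fin 2) : ℕ) : ℝ)

/-- Second planar coordinate of the point of a block tuple over `s`. [folklore] -/
def YS (s : Finset ι) (a : ι → Expo) : ℝ := (((∑ B ∈ s, a B) (1 : Fin 2) : ℕ) : ℝ)

/-- Membership in the shallow configuration, unfolded. [folklore] -/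
theorem mem_shallowCfg {s : Finset ι} {n : ℕ} {a : ι → Expo} :
    a ∈ shallowCfg F s n ↔ (∀ B, B ∉ s → a B = 0) ∧
      ∃ r : ι → ℕ, (∑ B ∈ s, r B) ≤ n ∧ ∀ B ∈ s, r B ≤ n ∧ a B ∈ F B (r B) := by
  classical
  unfold shallowCfg
  rw [Finset.mem_filter, Fintype.mem_piFinset]
  constructor
  · rintro ⟨hpi, r, hr, hrB⟩
    refine ⟨fun B hB => ?_, fun B => (r B : ℕ), hr, fun B hB => ⟨Nat.lt_succ_iff.1 (r B).isLt, hrB B hB⟩⟩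
    have := hpi B
    rw [if_neg hB, Finset.mem_singleton] at this
    exact this
  · rintro ⟨hoff, r, hr, hrB⟩
    refine ⟨fun B => ?_, fun B => ⟨min (r B) n, by omega⟩, ?_, fun B hB => ?_⟩
    · by_cases hB : B ∈ s
      · rw [if_pos hB, Finset.mem_biUnion]
        exact ⟨r B, Finset.mem_range.2 (Nat.lt_succ_of_le (hrB B hB).1), (hrB B hB).2⟩
      · rw [if_neg hB, Finset.mem_singleton]
        exact hoff B hB
    · calc (∑ B ∈ s, ((⟨min (r B) n, by omega⟩ : Fin (n + 1)) : ℕ)) = ∑ B ∈ s, r B :=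
            Finset.sum_congr rfl fun B hB => by simp [Nat.min_eq_left (hrB B hB).1]
        _ ≤ n := hr
    · have : ((⟨min (r B) n, by omega⟩ : Fin (n + 1)) : ℕ) = r B := by simp [Nat.min_eq_left (hrB B hB).1]
      rw [this]
      exact (hrB B hB).2

/-- The shallow configuration embeds into the frame box of `s`. [folklore] -/
theorem card_shallowCfg_le (s : Finset ι) (n : ℕ) :
    (shallowCfg F s n).card ≤ ∏ B ∈ s, ((Finset.range (n + 1)).biUnion (F B)).card := by
  classical
  unfold shallowCfg
  refine (Finset.card_filter_le _ _).trans ?_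
  rw [Fintype.card_piFinset]
  rw [← Finset.prod_mul_prod_compl s]
  have h2 : ∏ B ∈ sᶜ, (if B ∈ s then (Finset.range (n + 1)).biUnion (F B) else {0}).card = 1 :=
    Finset.prod_eq_one fun B hB => by rw [if_neg (Finset.mem_compl.1 hB), Finset.card_singleton]
  rw [h2, mul_one]
  exact le_of_eq (Finset.prod_congr rfl fun B hB => by rw [if_pos hB])

/-! ### Halving: restriction to a sub-block-set -/

/-- Restriction of a block tuple to a block set (zero elsewhere). [folklore] -/
def restrictTo (t : Finset ι) (a : ι → Expo) : ι → Expo := fun B => if B ∈ t then a B else 0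

/-- The restriction map `a ↦ (a|t, a|tᶜ)` is injective. [folklore] -/
theorem restrict_pair_injective (t : Finset ι) :
    Function.Injective fun a : ι → Expo => (restrictTo t a, restrictTo tᶜ a) := by
  intro a a' h
  have h1 : restrictTo t a = restrictTo t a' := congrArg Prod.fst h
  have h2 : restrictTo tᶜ a = restrictTo tᶜ a' := congrArg Prod.snd h
  funext B
  by_cases hB : B ∈ t
  · have := congrFun h1 B
    simpa [restrictTo, hB] using this
  · have := congrFun h2 B
    simpa [restrictTo, Finset.mem_compl.2 hB] using this

/-- **The image of the shallow configuration under halving** is exactly the union of the products of the shallow configurations of the two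
halves over the budget splits. [folklore] -/
theorem mem_halving_image_iff (s t : Finset ι) (hts : t ⊆ s) (n : ℕ)
    (p : (ι → Expo) × (ι → Expo)) :
    p ∈ (Finset.range (n + 1)).biUnion (fun n₁ => shallowCfg F t n₁ ×ˢ shallowCfg F (s \ t) (n - n₁)) ↔
      ∃ a ∈ shallowCfg F s n, (restrictTo t a, restrictTo tᶜ a) = p := by
  classical
  constructor
  · intro hp
    obtain ⟨n₁, hn₁, hp⟩ := Finset.mem_biUnion.1 hp
    obtain ⟨h1, h2⟩ := Finset.mem_product.1 hp
    obtain ⟨hoff1, r1, hr1, hrB1⟩ := (mem_shallowCfg F).1 h1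
    obtain ⟨hoff2, r2, hr2, hrB2⟩ := (mem_shallowCfg F).1 h2
    have hn₁' : n₁ ≤ n := Nat.lt_succ_iff.1 (Finset.mem_range.1 hn₁)
    refine ⟨fun B => p.1 B + p.2 B, (mem_shallowCfg F).2 ⟨fun B hB => ?_, fun B => if B ∈ t then r1 B else r2 B, ?_, fun B hB => ?_⟩, ?_⟩
    · rw [hoff1 B (fun h => hB (hts h)), hoff2 B (fun h => hB (Finset.mem_sdiff.1 h).1), add_zero]
    · rw [← Finset.sum_filter_add_sum_filter_not s (fun B => B ∈ t)]
      have e1 : s.filter (fun B => B ∈ t) = t := by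
        ext B; simp only [Finset.mem_filter]; exact ⟨fun h => h.2, fun h => ⟨hts h, h⟩⟩
      have e2 : s.filter (fun B => ¬ B ∈ t) = s \ t := by
        ext B; simp [Finset.mem_sdiff]
      rw [e1, e2]
      have s1 : ∑ B ∈ t, (if B ∈ t then r1 B else r2 B) = ∑ B ∈ t, r1 B :=
        Finset.sum_congr rfl fun B hB => if_pos hB
      have s2 : ∑ B ∈ s \ t, (if B ∈ t then r1 B else r2 B) = ∑ B ∈ s \ t, r2 B :=
        Finset.sum_congr rfl fun B hB => if_neg (Finset.mem_sdiff.1 hB).2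
      rw [s1, s2]
      omega
    · dsimp only
      by_cases hBt : B ∈ t
      · rw [if_pos hBt, hoff2 B (fun h => (Finset.mem_sdiff.1 h).2 hBt), add_zero]
        exact ⟨(hrB1 B hBt).1.trans hn₁', (hrB1 B hBt).2⟩
      · have hB2 : B ∈ s \ t := Finset.mem_sdiff.2 ⟨hB, hBt⟩
        rw [if_neg hBt, hoff1 B hBt, zero_add]
        exact ⟨(hrB2 B hB2).1.trans (Nat.sub_le n n₁), (hrB2 B hB2).2⟩
    · refine Prod.ext ?_ ?_
      · funext B
        simp only [restrictTo]
        split_ifs with hBt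
        · rw [hoff2 B (fun h => (Finset.mem_sdiff.1 h).2 hBt), add_zero]
        · exact (hoff1 B hBt).symm
      · funext B
        simp only [restrictTo]
        split_ifs with hBt
        · rw [hoff1 B (fun h => (Finset.mem_compl.1 hBt) h), zero_add]
        · exact (hoff2 B (fun h => hBt (Finset.mem_compl.2 (Finset.mem_sdiff.1 h).2))).symm
  · rintro ⟨a, ha, rfl⟩
    obtain ⟨hoff, r, hr, hrB⟩ := (mem_shallowCfg F).1 ha
    set n₁ := ∑ B ∈ t, r B with hn₁
    have hsplit : ∑ B ∈ s, r B = n₁ + ∑ B ∈ s \ t, r B := by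
      rw [← Finset.sum_filter_add_sum_filter_not s (fun B => B ∈ t)]
      have e1 : s.filter (fun B => B ∈ t) = t := by
        ext B; simp only [Finset.mem_filter]; exact ⟨fun h => h.2, fun h => ⟨hts h, h⟩⟩
      have e2 : s.filter (fun B => ¬ B ∈ t) = s \ t := by
        ext B; simp [Finset.mem_sdiff]
      rw [e1, e2]
    have hn₁le : n₁ ≤ n := by omega
    refine Finset.mem_biUnion.2 ⟨n₁, Finset.mem_range.2 (Nat.lt_succ_of_le hn₁le), Finset.mem_product.2 ⟨?_, ?_⟩⟩
    · refine (mem_shallowCfg F).2 ⟨fun B hB => if_neg hB, r, le_rfl, fun B hB => ⟨?_, ?_⟩⟩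
      · exact Finset.single_le_sum (fun B _ => Nat.zero_le (r B)) hB
      · simp only [restrictTo, if_pos hB]
        exact (hrB B (hts hB)).2
    · refine (mem_shallowCfg F).2 ⟨fun B hB => ?_, r, by omega, fun B hB => ⟨?_, ?_⟩⟩
      · simp only [restrictTo]
        split_ifs with hBc
        · exact hoff B (fun h => hB (Finset.mem_sdiff.2 ⟨h, Finset.mem_compl.1 hBc⟩))
        · rfl
      · have : r B ≤ ∑ B' ∈ s \ t, r B' := Finset.single_le_sum (fun B _ => Nat.zero_le (r B)) hB
        omega
      · simp only [restrictTo, if_pos (Finset.mem_compl.2 (Finset.mem_sdiff.1 hB).2)]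
        exact (hrB B (Finset.mem_sdiff.1 hB).1).2

/-- Columns split multiplicatively under halving. [folklore] -/
theorem colS_halving (s t : Finset ι) (hts : t ⊆ s) (a : ι → Expo) :
    colS c t (restrictTo t a) * colS c (s \ t) (restrictTo tᶜ a) = colS c s a := by
  funext i
  simp only [Pi.mul_apply, colS]
  have h1 : ∏ B ∈ t, c B (restrictTo t a B) i = ∏ B ∈ t, c B (a B) i :=
    Finset.prod_congr rfl fun B hB => by simp [restrictTo, hB]
  have h2 : ∏ B ∈ s \ t, c B (restrictTo tᶜ a B) i = ∏ B ∈ s \ t, c B (a B) i :=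
    Finset.prod_congr rfl fun B hB => by simp [restrictTo, (Finset.mem_sdiff.1 hB).2]
  rw [h1, h2, ← Finset.prod_union (Finset.disjoint_sdiff), Finset.union_sdiff_of_subset hts]

/-- Points split additively under halving. [folklore] -/
theorem sum_halving (s t : Finset ι) (hts : t ⊆ s) (a : ι → Expo) :
    ∑ B ∈ t, restrictTo t a B + ∑ B ∈ s \ t, restrictTo tᶜ a B = ∑ B ∈ s, a B := by
  have h1 : ∑ B ∈ t, restrictTo t a B = ∑ B ∈ t, a B :=
    Finset.sum_congr rfl fun B hB => by simp [restrictTo, hB]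
  have h2 : ∑ B ∈ s \ t, restrictTo tᶜ a B = ∑ B ∈ s \ t, a B :=
    Finset.sum_congr rfl fun B hB => by simp [restrictTo, (Finset.mem_sdiff.1 hB).2]
  rw [h1, h2, ← Finset.sum_union (Finset.disjoint_sdiff), Finset.union_sdiff_of_subset hts]

/-! ### The recursion -/

/-- Elementary arithmetic of one piece of the recursion. [folklore] -/
theorem piece_arith (k S s₁ s₂ : ℕ) (hS : 1 ≤ S) (h₁ : s₁ ≤ S) (h₂ : s₂ ≤ S) :
    2 * (k * k * (k * s₁ + k * s₂ + 1)) + k + k + 1 ≤ 8 * (k + 2) ^ 3 * S := by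
  have hk : 4 * k ^ 3 + 2 * k ^ 2 + 2 * k + 1 ≤ 8 * (k + 2) ^ 3 := by nlinarith
  calc 2 * (k * k * (k * s₁ + k * s₂ + 1)) + k + k + 1
      ≤ 2 * (k * k * (k * S + k * S + 1)) + k + k + 1 := by gcongr
    _ = 4 * k ^ 3 * S + (2 * k ^ 2 + 2 * k + 1) := by ring
    _ ≤ 4 * k ^ 3 * S + (2 * k ^ 2 + 2 * k + 1) * S := by
        have := Nat.mul_le_mul_left (2 * k ^ 2 + 2 * k + 1) hS; simpa using this
    _ = (4 * k ^ 3 + 2 * k ^ 2 + 2 * k + 1) * S := by ring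
    _ ≤ 8 * (k + 2) ^ 3 * S := Nat.mul_le_mul_right _ hk

/-- **SHALLOW THEOREM Q (abstract).**  If every block frame `⋃_{r ≤ n} F_B(r)` has at most `σ` points, then for every block set `s` and
every budget `n' ≤ n` the configuration shadow of the shallow configuration has at most `(σ + 2)·((n'+1)·8(k+2)³)^⌈log₂ #s⌉` points. [folklore] -/
theorem ncard_cshadow_shallow_le (n σ : ℕ) (hσ : ∀ B, ((Finset.range (n + 1)).biUnion (F B)).card ≤ σ) :
    ∀ (N : ℕ) (s : Finset ι), s.card = N → ∀ n', n' ≤ n →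
      (QuasiPoly.cshadow (shallowCfg F s n') (colS c s) (XS s) (YS s)).ncard ≤
        (σ + 2) * ((n' + 1) * (8 * (k + 2) ^ 3)) ^ Nat.clog 2 N := by
  classical
  intro N
  induction N using Nat.strong_induction_on with
  | _ N ih =>
    intro s hs n' hn'
    have hframe : ∀ B, ((Finset.range (n' + 1)).biUnion (F B)).card ≤ σ := fun B =>
      (Finset.card_le_card (Finset.biUnion_subset_biUnion_of_subset_left _
        (Finset.range_subset_range.2 (by omega)))).trans (hσ B)
    have hβ : 1 ≤ ((n' + 1) * (8 * (k + 2) ^ 3)) ^ Nat.clog 2 N := Nat.one_le_pow _ _ (by positivity)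
    rcases Nat.lt_or_ge N 2 with hN | hN
    · -- `#s ≤ 1`: the configuration itself is small
      have hE : (shallowCfg F s n').card ≤ σ + 2 := by
        refine (card_shallowCfg_le F s n').trans ?_
        interval_cases N
        · rw [Finset.card_eq_zero.1 hs]; simp
        · obtain ⟨B, rfl⟩ := Finset.card_eq_one.1 hs
          rw [Finset.prod_singleton]
          exact (hframe B).trans (Nat.le_add_right _ _)
      calc (QuasiPoly.cshadow (shallowCfg F s n') (colS c s) (XS s) (YS s)).ncard
          ≤ ((shallowCfg F s n' : Finset _) : Set (ι → Expo)).ncard :=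
            Set.ncard_le_ncard (QuasiPoly.cshadow_subset _ _ _ _) (Finset.finite_toSet _)
        _ = (shallowCfg F s n').card := Set.ncard_coe_finset _
        _ ≤ (σ + 2) * 1 := by rw [mul_one]; exact hE
        _ ≤ _ := Nat.mul_le_mul_left _ hβ
    · -- halving
      obtain ⟨t, hts, htcard⟩ := Finset.exists_subset_card_eq (show (N + 1) / 2 ≤ s.card by omega)
      set N₁ := (N + 1) / 2 with hN₁
      set N₂ := N - N₁ with hN₂
      have hsd : (s \ t).card = N₂ := by rw [Finset.card_sdiff_of_subset hts, hs, htcard]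
      have hN₁lt : N₁ < N := by omega
      have hN₂lt : N₂ < N := by omega
      have hc₁ : Nat.clog 2 N₁ + 1 = Nat.clog 2 N := by
        have h := Nat.clog_of_two_le (b := 2) one_lt_two hN
        have : (N + 2 - 1) / 2 = (N + 1) / 2 := by omega
        rw [this, ← hN₁] at h; omega
      have hc₂ : Nat.clog 2 N₂ + 1 ≤ Nat.clog 2 N := by
        have hmono := Nat.clog_mono_right 2 (show N₂ ≤ N₁ by omega)
        omega
      set C := Nat.clog 2 N with hC
      set Λ : ℕ := (n' + 1) * (8 * (k + 2) ^ 3) with hΛ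
      set S : ℕ := (σ + 2) * Λ ^ (C - 1) with hSdef
      have hS1 : 1 ≤ S := by
        have : 1 ≤ Λ ^ (C - 1) := Nat.one_le_pow _ _ (by positivity)
        calc 1 ≤ (σ + 2) * 1 := by omega
          _ ≤ S := Nat.mul_le_mul_left _ this
      -- the sub-shadows at every budget `≤ n'` are bounded by `S`
      have hsub : ∀ (s' : Finset ι) (N' : ℕ), s'.card = N' → N' < N → Nat.clog 2 N' + 1 ≤ C → ∀ n₁, n₁ ≤ n' →
          (QuasiPoly.cshadow (shallowCfg F s' n₁) (colS c s') (XS s') (YS s')).ncard ≤ S := by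
        intro s' N' hs' hN' hcl n₁ hn₁
        refine (ih N' hN' s' hs' n₁ (hn₁.trans hn')).trans ?_
        rw [hSdef]
        refine Nat.mul_le_mul_left _ ?_
        calc ((n₁ + 1) * (8 * (k + 2) ^ 3)) ^ Nat.clog 2 N' ≤ Λ ^ Nat.clog 2 N' :=
              Nat.pow_le_pow_left (Nat.mul_le_mul_right _ (by omega)) _
          _ ≤ Λ ^ (C - 1) := Nat.pow_le_pow_right (by positivity) (by omega)
      -- embedding into the union of products
      have hemb : (QuasiPoly.cshadow (shallowCfg F s n') (colS c s) (XS s) (YS s)).ncard ≤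
          (QuasiPoly.cshadow ((Finset.range (n' + 1)).biUnion (fun n₁ => shallowCfg F t n₁ ×ˢ shallowCfg F (s \ t) (n' - n₁)))
            (fun p : (ι → Expo) × (ι → Expo) => colS c t p.1 * colS c (s \ t) p.2)
            (fun p => XS t p.1 + XS (s \ t) p.2) (fun p => YS t p.1 + YS (s \ t) p.2)).ncard := by
        refine QuasiPoly.ncard_cshadow_le_of_embedding _ _ _ _ _ _ _ _ (fun a => (restrictTo t a, restrictTo tᶜ a))
          (restrict_pair_injective t) (fun p => mem_halving_image_iff F s t hts n' p) (fun a => ?_) (fun a => ?_) (fun a => ?_)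
        · exact colS_halving c s t hts a
        · simp only [XS, ← sum_halving s t hts a, Finsupp.add_apply, Nat.cast_add]
        · simp only [YS, ← sum_halving s t hts a, Finsupp.add_apply, Nat.cast_add]
      refine hemb.trans ((ncard_cshadow_biUnion_le _ _ _ _ _).trans ?_)
      have hpiece : ∀ n₁ ∈ Finset.range (n' + 1),
          (QuasiPoly.cshadow (shallowCfg F t n₁ ×ˢ shallowCfg F (s \ t) (n' - n₁))
            (fun p : (ι → Expo) × (ι → Expo) => colS c t p.1 * colS c (s \ t) p.2)
            (fun p => XS t p.1 + XS (s \ t) p.2) (fun p => YS t p.1 + YS (s \ t) p.2)).ncard ≤ 8 * (k + 2) ^ 3 * S := by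
        intro n₁ hn₁
        have hn₁' : n₁ ≤ n' := Nat.lt_succ_iff.1 (Finset.mem_range.1 hn₁)
        have h1 := hsub t N₁ htcard hN₁lt (by omega) n₁ hn₁'
        have h2 := hsub (s \ t) N₂ hsd hN₂lt hc₂ (n' - n₁) ((Nat.sub_le _ _).trans le_rfl)
        exact (QuasiPoly.ncard_cshadow_prod_le _ _ _ _ _ _ _ _).trans (piece_arith k S _ _ hS1 h1 h2)
      calc ∑ n₁ ∈ Finset.range (n' + 1), (QuasiPoly.cshadow (shallowCfg F t n₁ ×ˢ shallowCfg F (s \ t) (n' - n₁))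
              (fun p : (ι → Expo) × (ι → Expo) => colS c t p.1 * colS c (s \ t) p.2)
              (fun p => XS t p.1 + XS (s \ t) p.2) (fun p => YS t p.1 + YS (s \ t) p.2)).ncard
          ≤ ∑ _n₁ ∈ Finset.range (n' + 1), 8 * (k + 2) ^ 3 * S := Finset.sum_le_sum hpiece
        _ = (n' + 1) * (8 * (k + 2) ^ 3 * S) := by rw [Finset.sum_const, Finset.card_range, smul_eq_mul]
        _ = (σ + 2) * ((n' + 1) * (8 * (k + 2) ^ 3)) ^ C := by
            have hC1 : C = (C - 1) + 1 := by omega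
            rw [hSdef, hΛ]
            conv_rhs => rw [hC1, pow_succ]
            ring

end Shallow

end Summit.ValiantsHypothesis.ValiantsHypothesis.Theorems.NewtonUnitEquations.TwoProducts.ExpBlock

end
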